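import Mathlib
import Literature.Combinatorics.Kakeya.FiniteFieldKakeya
import HarnessLib

/-!
# Rules exact for monomials: the lower bound on the number of points (Davis–Rabinowitz 1984, Sect. 5.7)

Davis–Rabinowitz, *Methods of Numerical Integration* (2nd ed., 1984), Sect. 5.7 "Rules Exact for Monomials",
pp. 365–366, THEOREM (5.7.4): an `n`-point rule `R(f) = Σ_k w_k f(P_k)` of precision `p` for a region `B ⊆ ℝ^d`
satisfies `C(d + ⌊p/2⌋, ⌊p/2⌋) ≤ n ≤ C(d + p, p)`.  Proof of the lower bound (loc. cit.): if the `m` monomials of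
degree `≤ ⌊p/2⌋` outnumber the points, some nontrivial combination `g` of them vanishes at every `P_k`; then
`g²` has degree `≤ p`, so `0 ≠ ∫_B g² = R(g²) = Σ_k w_k g(P_k)² = 0`, a contradiction.

Recorded: the lower bound, in the generality of that proof — (i) for an abstract finite-dimensional space `V` of
functions and any functional `I` that is *definite* on squares from `V` (`I(g²) = 0 ⇒ g = 0`) and reproduced by the
rule on those squares: `dim V ≤ #nodes`; (ii) for multivariate polynomials: a rule exact on total degree `≤ p`
for a functional definite on `{g² : deg g ≤ k}`, `2k ≤ p`, has at least `dim 𝒫_k = C(d + k, k)` nodes (the monomial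
count is the tree's `choose_le_finrank_restrictTotalDegree`).  The definiteness hypothesis is what "region" supplies
in the book (a set with interior); it is kept as a hypothesis here.  The upper bound (Tchakaloff) is not recorded.

Provenance: engines group, shared numerical engines serving client cells; rigour lives in the verifiers; every
published number belongs to a client cell's ledger, not to the engines group.  Textbook facts only (no client
numbers).
-/

namespace Literature.Analysis.Quadrature

open MvPolynomial Finset

section Abstract

variable {K : Type*} [Field K] {B ι : Type*} [Fintype ι]

/-- THEOREM (5.7.4), lower bound, abstract form: if a rule with nodes `P` and weights `w` reproduces a functional
`I` on the squares `g²`, `g ∈ V`, and `I` is definite there, then `dim V ≤ #nodes`.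
[cite: DavisRabinowitz1984, Sect. 5.7 Theorem (5.7.4)] -/
theorem finrank_le_card_of_exact_on_squares (V : Submodule K (B → K)) [FiniteDimensional K V] (P : ι → B)
    (w : ι → K) (I : (B → K) → K) (hexact : ∀ g ∈ V, ∑ i, w i * (g (P i) * g (P i)) = I (g * g))
    (hdef : ∀ g ∈ V, I (g * g) = 0 → g = 0) : Module.finrank K V ≤ Fintype.card ι := by
  refine le_of_not_gt fun hlt => ?_
  let ev : V →ₗ[K] (ι → K) :=
    { toFun := fun g i => (g : B → K) (P i)
      map_add' := fun g h => by ext i; simp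
      map_smul' := fun c g => by ext i; simp }
  have hker : LinearMap.ker ev ≠ ⊥ :=
    LinearMap.ker_ne_bot_of_finrank_lt (by simpa [Module.finrank_fintype_fun_eq_card] using hlt)
  obtain ⟨g, hg, hg0⟩ := (Submodule.ne_bot_iff _).1 hker
  have hgP : ∀ i, (g : B → K) (P i) = 0 := fun i => congr_fun (LinearMap.mem_ker.1 hg) i
  have h0 : I ((g : B → K) * g) = 0 := by
    rw [← hexact g g.2]
    simp [hgP]
  exact hg0 (Subtype.ext (hdef g g.2 h0))

end Abstract

section Polynomial

variable {K : Type*} [Field K] {σ ι : Type*} [Finite σ] [Fintype ι]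

/-- THEOREM (5.7.4), lower bound, for multivariate polynomial precision: a rule exact on total degree `≤ p`
for a functional `I` definite on squares of polynomials of degree `≤ k`, `2k ≤ p`, has at least `dim 𝒫_k` nodes.
[cite: DavisRabinowitz1984, Sect. 5.7 Theorem (5.7.4)] -/
theorem finrank_restrictTotalDegree_le_card_of_exact (P : ι → σ → K) (w : ι → K) (I : MvPolynomial σ K → K)
    {k p : ℕ} (hkp : 2 * k ≤ p)
    (hexact : ∀ q : MvPolynomial σ K, q.totalDegree ≤ p → ∑ i, w i * eval (P i) q = I q)
    (hdef : ∀ g : MvPolynomial σ K, g.totalDegree ≤ k → I (g * g) = 0 → g = 0) :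
    Module.finrank K (restrictTotalDegree σ K k) ≤ Fintype.card ι := by
  refine le_of_not_gt fun hlt => ?_
  let ev : restrictTotalDegree σ K k →ₗ[K] (ι → K) :=
    LinearMap.pi fun i => (MvPolynomial.aeval (P i)).toLinearMap ∘ₗ (restrictTotalDegree σ K k).subtype
  have hker : LinearMap.ker ev ≠ ⊥ :=
    LinearMap.ker_ne_bot_of_finrank_lt (by simpa [Module.finrank_fintype_fun_eq_card] using hlt)
  obtain ⟨g, hg, hg0⟩ := (Submodule.ne_bot_iff _).1 hker
  have hgk : (g : MvPolynomial σ K).totalDegree ≤ k := (mem_restrictTotalDegree _ _ _).1 g.2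
  have hgP : ∀ i, eval (P i) (g : MvPolynomial σ K) = 0 := fun i => by
    have := congr_fun (LinearMap.mem_ker.1 hg) i
    simpa [ev, coe_aeval_eq_eval] using this
  have hsq : ((g : MvPolynomial σ K) * g).totalDegree ≤ p :=
    (totalDegree_mul _ _).trans (by omega)
  have h0 : I ((g : MvPolynomial σ K) * g) = 0 := by
    rw [← hexact _ hsq]
    simp [hgP]
  exact hg0 (Subtype.ext (hdef _ hgk h0))

/-- THEOREM (5.7.4), lower bound, as the binomial count in `d` variables: `C(d + k, k) ≤ n` for a rule of
precision `p ≥ 2k` (definite functional). [cite: DavisRabinowitz1984, Sect. 5.7 Theorem (5.7.4)] -/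
theorem choose_le_card_of_exact {d : ℕ} (P : ι → Fin d → K) (w : ι → K) (I : MvPolynomial (Fin d) K → K)
    {k p : ℕ} (hkp : 2 * k ≤ p)
    (hexact : ∀ q : MvPolynomial (Fin d) K, q.totalDegree ≤ p → ∑ i, w i * eval (P i) q = I q)
    (hdef : ∀ g : MvPolynomial (Fin d) K, g.totalDegree ≤ k → I (g * g) = 0 → g = 0) :
    (d + k).choose k ≤ Fintype.card ι := by
  have h1 := Literature.Combinatorics.Kakeya.FiniteFieldKakeya.choose_le_finrank_restrictTotalDegree (K := K) d k
  rw [← Nat.choose_symm_add] at h1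
  rw [add_comm]
  exact h1.trans (finrank_restrictTotalDegree_le_card_of_exact P w I hkp hexact hdef)

/-- The book's form with `k = ⌊p/2⌋`: a rule of precision `p` in `d` variables has at least `C(d + ⌊p/2⌋, ⌊p/2⌋)`
points. [cite: DavisRabinowitz1984, Sect. 5.7 Theorem (5.7.4)] -/
theorem choose_half_le_card_of_exact {d : ℕ} (P : ι → Fin d → K) (w : ι → K)
    (I : MvPolynomial (Fin d) K → K) (p : ℕ)
    (hexact : ∀ q : MvPolynomial (Fin d) K, q.totalDegree ≤ p → ∑ i, w i * eval (P i) q = I q)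
    (hdef : ∀ g : MvPolynomial (Fin d) K, g.totalDegree ≤ p / 2 → I (g * g) = 0 → g = 0) :
    (d + p / 2).choose (p / 2) ≤ Fintype.card ι :=
  choose_le_card_of_exact P w I (by omega) hexact hdef

end Polynomial

end Literature.Analysis.Quadrature
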